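import Literature.MathematicalPhysics.QuantumFieldTheory.Balaban1983to89.Beta.SquareTable
import Summits.QuantumFields.BalabanUV.Beta.D1BFx.ScaledWindowCount

/-!
# `BalabanUV.Beta.D1BFx.GhostRelegging` — road «BF-x» for binder row D1, leaf A2′: RE-LEGGING A SECTOR OF THE REALISED TABLE
# FROM ONE SCALAR LEG FAMILY TO ANOTHER COSTS `O(1)`, UNIFORMLY IN THE BLOCK SIZE

HONEST FRAMING (cell contract, verbatim): «discharging `BetaPertH` makes Bałaban's UV stability UNCONDITIONAL — a real constructive-QFT
result; it is NOT the continuum limit and NOT the Clay problem.»  This module is [folklore] window/tail bookkeeping composed BY NAME from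
the tree (`WindowInterface.inWindow_of_legPerturbation`, `WindowInterface.shellBound_of_legDecay`, `WindowInterface.windowBound_of_scaleBound`,
`SquareTable.stP/stQ/bfCoeff/bfP/bfQ/abs_stP_le/abs_stQ_le/abs_stP_le_of_decay/abs_stQ_le_of_decay`, `D1BFx.ScaledWindowCount.abs_fullSum_le_of_scaledWindow`
at `p = 2`, `WindowIdentification.fullSum/psum/exists_tendsto_psum_of_shellBound`).  It cites nothing, mints no `Prop`, discharges nothing of the
wall; NOT summit progress; NOT continuum, NOT Clay.  HONEST DEPENDENCY: continuum YM on T⁴ ⇐ BetaPertH ∧ nine spine estimates (0/9 proved);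
BetaPertH ⇐ (D1) ∧ (D4) ∧ CAP+tail; G-an2-4 gates asym, D1 and NE2/3/4.

WHY (skeleton `HOME/beta/skeletons/D1-b2b-balaban-beta-d1-p2.md` v1.4, node A, leaf A2′ «ghost sector re-legged onto `GfE` at O(1)»; node L,
leaf L2 «re-legging the ghost sector onto the gluon diagonal `σ := GfE` at O(1) cost, both being `gFree + O(n⁻²)`-graded»).  In the
background-Feynman one-shot the gluon bubble runs over the diagonal gluon leg `σ_n b` and the ghost bubble over the ghost leg `γ_n b`; an3's
ONE-kernel scalar END `SquareTable.oneLoopDrift_of_scalarBounds_avg` wants BOTH sectors over the SAME leg.  This module proves, ONCE and for an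
arbitrary index sub-family `I ⊆ BfIdx` of an3's realised table (the ghost sector is `ghostIdx` = the `Sum.inr` indices, the gluon sector
`gluonIdx`, the whole table `Finset.univ`), that if two scalar leg kernels `G₁, G₂ : ℤ⁴ → ℝ` BOTH obey, at block size `n ≥ 2`, the six graded
scalar rows `h0/h1/h2` (window, against `gFree`: `D₀/n², D₁/n³, D₂/n⁴`) and `d0/d1/d2` (decay `A_je^{−(δ/n)‖v‖∞}‖v‖∞^{−2−j}`) of that END, then
the `(1.22)`-weighted `I`-sector stencil kernels `stKI I G₁`, `stKI I G₂` have full lattice sums differing by at most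
`160·Dwin + 160·Etail·(1 + 1/δ)`, with `Dwin`, `Etail` explicit polynomials in `(D, A, |bfCoeff N|, table constants)` — INDEPENDENT OF `n` and of
the base point.  Mechanism: on the window `‖w‖∞ ≤ n` both kernels are within `Dwin/(‖w‖∞²n²)` of the free table integrand
(`inWindow_of_legPerturbation`), so their difference is in the `p = 2` class of `ScaledWindowCount` (window sum `≤ 160·Dwin`); beyond, each has
the scale-`n` massive tail `Etail(r+1)⁻⁴e^{−(δ/n)(r+1)}` (`shellBound_of_legDecay`), summing to `≤ 160·Etail(1 + 1/δ)`.  Nothing about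
Bałaban's propagators is asserted: the twelve rows are hypotheses, exactly the binder shapes of `D1BFx.RoadEnd.d1Drift_of_strongRoad`.

CONTENT (all [folklore]).
* `stKI` (`stKI_univ : stKI univ = stK`, `stK_eq_gluon_add_ghost`); `stP/stQ_window_of_rows` — rows at scale `n` ⇒ (W2′) leg bounds.
* `abs_stKI_sub_stKI_le_of_window` — two families on the window ⇒ `|stKI I G₁ w − stKI I G₂ w| ≤ 2·Dwin/(‖w‖∞²·n²)`.
* `abs_stKI_le_of_decay` — decay rows ⇒ `|stKI I G w| ≤ Etail·(r+1)⁻⁴·e^{−c(r+1)}` on the shell `‖w‖∞ = r+1`, `r ≥ 1`.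
* `exists_tendsto_psum_stKI` — hence `fullSum (stKI I G)` exists.
* `abs_fullSum_stKI_sub_le` — THE RE-LEGGING BOUND at one scale `n ≥ 2`, explicit constant.
* `abs_avg_fullSum_stKI_sub_le` — the base-point-averaged, all-scales form in the shape of `RoadEnd.d1Drift_of_strongRoad`'s rows.
-/

namespace Summit.QuantumFields.BalabanUV.Beta.D1BFx.GhostRelegging

open Finset Filter Topology
open scoped BigOperators
open Literature.Probability.LatticeModels (annulus)
open Literature.MathematicalPhysics.QuantumFieldTheory.Balaban1983to89
open Literature.MathematicalPhysics.QuantumFieldTheory.Balaban1983to89.Beta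
open DyadicShell (Pt toReal supNorm supNorm_eq_of_mem_sphere ne_zero_of_mem_annulus mem_annulus_iff)
open BubbleTransfer (Leg lattBubble unitVec)
open GhostTable (gFree)
open SquareTable (BfIdx bfCoeff bfP bfQ stP stQ stK hdeg_bf stP_free stQ_free stP_sub stQ_sub abs_stP_le abs_stQ_le
  two_le_bfP_a two_le_bfQ_a abs_stP_le_of_decay abs_stQ_le_of_decay)
open WindowInterface (inWindow_of_legPerturbation shellBound_of_legDecay windowBound_of_scaleBound)
open WindowIdentification (psum fullSum fullSum_eq_of_tendsto exists_tendsto_psum_of_shellBound)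
open ScaledWindowCount (abs_fullSum_le_of_scaledWindow)

noncomputable section

variable {μ ν : Fin 4}

/-! ## 1. The `I`-sector stencil kernel -/

/-- [folklore] **THE WEIGHTED `I`-SECTOR STENCIL KERNEL** `w_μw_ν·Σ_{i∈I} bfCoeff_i·stP_i G·stQ_i G (w)`: an3's `stK` restricted to an
index sub-family `I ⊆ BfIdx = Fin 4 ⊕ Bool` of the realised background-field table (gluon sector `inl`, ghost sector `inr`). -/
def stKI (μ ν : Fin 4) (N : ℝ) (I : Finset BfIdx) (G : Pt → ℝ) (w : Pt) : ℝ :=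
  toReal w μ * toReal w ν * ∑ i ∈ I, bfCoeff N i * (stP μ ν G i w * stQ μ ν G i w)

/-- [folklore] The gluon sector of the realised table: the `Sum.inl` indices (`sqP/sqQ`, coefficients `8N²`). -/
def gluonIdx : Finset BfIdx := Finset.univ.map Function.Embedding.inl

/-- [folklore] The ghost sector of the realised table: the `Sum.inr` indices (`ghostP/ghostQ`, coefficients `∓2N²`). -/
def ghostIdx : Finset BfIdx := Finset.univ.map Function.Embedding.inr

/-- [folklore] On the whole index set the `I`-sector kernel IS an3's `stK`. -/
theorem stKI_univ (μ ν : Fin 4) (N : ℝ) (G : Pt → ℝ) : stKI μ ν N Finset.univ G = stK μ ν N G := rfl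

/-- [folklore] `stK = stKI gluonIdx + stKI ghostIdx` (the table splits into its two sectors). -/
theorem stK_eq_gluon_add_ghost (μ ν : Fin 4) (N : ℝ) (G : Pt → ℝ) (w : Pt) :
    stK μ ν N G w = stKI μ ν N gluonIdx G w + stKI μ ν N ghostIdx G w := by
  rw [← stKI_univ, stKI, stKI, stKI, gluonIdx, ghostIdx, Finset.sum_map, Finset.sum_map, Fintype.sum_sum_type]
  simp only [Function.Embedding.inl_apply, Function.Embedding.inr_apply]
  ring

/-! ## 2. Graded rows at one scale ⇒ the (W2′) leg-interface bounds on the window -/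

section Rows

/-- [folklore] **FIRST LEGS.**  At block size `n`, the three graded window rows of `G` against `gFree` (`D₀/n², D₁/n³, D₂/n⁴` on the
whole lattice) give, at every window point `0 < ‖w‖∞ ≤ n`, `|stP_i G (w) − (bfP_i).f (w)| ≤ D_{a_i−2}/(‖w‖∞^{a_i−2}·n²)` — the
`hF` binder shape of `WindowInterface` (the `n`-uniform step of `SquareTable.hF_of_graded`, isolated). -/
theorem stP_window_of_rows (hμν : μ ≠ ν) {n : ℕ} {G : Pt → ℝ} {D : ℕ → ℝ} (hD : ∀ j, 0 ≤ D j)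
    (h0 : ∀ v, |G v - gFree v| ≤ D 0 / (n : ℝ) ^ 2)
    (h1 : ∀ v (ρ : Fin 4), |(G (v + unitVec ρ) - gFree (v + unitVec ρ)) - (G v - gFree v)| ≤ D 1 / (n : ℝ) ^ 3)
    (h2 : ∀ v, |(G (v + unitVec ν + unitVec μ) - gFree (v + unitVec ν + unitVec μ)) - (G (v + unitVec ν) - gFree (v + unitVec ν)) -
        (G (v + unitVec μ) - gFree (v + unitVec μ)) + (G v - gFree v)| ≤ D 2 / (n : ℝ) ^ 4)
    {w : Pt} (hw : w ≠ 0) (hwn : (supNorm w : ℝ) ≤ n) (i : BfIdx) :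
    |stP μ ν G i w - (bfP hμν i).f n 0 w| ≤ D ((bfP hμν i).a - 2) / ((supNorm w : ℝ) ^ ((bfP hμν i).a - 2) * (n : ℝ) ^ 2) := by
  have ha := two_le_bfP_a hμν i
  have key : |stP μ ν G i w - (bfP hμν i).f n 0 w| ≤ D ((bfP hμν i).a - 2) / (n : ℝ) ^ (bfP hμν i).a := by
    rw [← stP_free hμν i n 0 w, stP_sub]
    have hb := abs_stP_le hμν (E := G - gFree) (e := fun j => D j / (n : ℝ) ^ (j + 2))
      (fun v => by simpa using h0 v) (fun v ρ => by simpa using h1 v ρ) (fun v => by simpa using h2 v) i w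
    have hx : (bfP hμν i).a - 2 + 2 = (bfP hμν i).a := Nat.sub_add_cancel ha
    simp only [hx] at hb
    exact hb
  exact windowBound_of_scaleBound (hD _) ha hw hwn key

/-- [folklore] **SECOND LEGS** (`hG` binder shape, constant `D_{b_i−2}`). -/
theorem stQ_window_of_rows (hμν : μ ≠ ν) {n : ℕ} {G : Pt → ℝ} {D : ℕ → ℝ} (hD : ∀ j, 0 ≤ D j)
    (h0 : ∀ v, |G v - gFree v| ≤ D 0 / (n : ℝ) ^ 2)
    (h1 : ∀ v (ρ : Fin 4), |(G (v + unitVec ρ) - gFree (v + unitVec ρ)) - (G v - gFree v)| ≤ D 1 / (n : ℝ) ^ 3)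
    (h2 : ∀ v, |(G (v + unitVec ν + unitVec μ) - gFree (v + unitVec ν + unitVec μ)) - (G (v + unitVec ν) - gFree (v + unitVec ν)) -
        (G (v + unitVec μ) - gFree (v + unitVec μ)) + (G v - gFree v)| ≤ D 2 / (n : ℝ) ^ 4)
    {w : Pt} (hw : w ≠ 0) (hwn : (supNorm w : ℝ) ≤ n) (i : BfIdx) :
    |stQ μ ν G i w - (bfQ hμν i).f n 0 w| ≤ D ((bfQ hμν i).a - 2) / ((supNorm w : ℝ) ^ ((bfQ hμν i).a - 2) * (n : ℝ) ^ 2) := by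
  have ha := two_le_bfQ_a hμν i
  have key : |stQ μ ν G i w - (bfQ hμν i).f n 0 w| ≤ D ((bfQ hμν i).a - 2) / (n : ℝ) ^ (bfQ hμν i).a := by
    rw [← stQ_free hμν i n 0 w, stQ_sub]
    have hb := abs_stQ_le hμν (E := G - gFree) (e := fun j => D j / (n : ℝ) ^ (j + 2))
      (fun v => by simpa using h0 v) (fun v ρ => by simpa using h1 v ρ) (fun v => by simpa using h2 v) i w
    have hx : (bfQ hμν i).a - 2 + 2 = (bfQ hμν i).a := Nat.sub_add_cancel ha
    simp only [hx] at hb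
    exact hb
  exact windowBound_of_scaleBound (hD _) ha hw hwn key

end Rows

/-! ## 3. Two families on the window: the difference is in the `p = 2` class -/

section Window

/-- [folklore] The window constant `Dwin(I; R, S) = Σ_{i∈I} |bfCoeff_i|·((A_{P_i}+B_{P_i})S_i + R_i(A_{Q_i}+B_{Q_i}) + R_iS_i)` of
`WindowInterface.inWindow_of_legPerturbation` is nonnegative for nonnegative `R, S`. -/
theorem winConst_nonneg (hμν : μ ≠ ν) (N : ℝ) (I : Finset BfIdx) {R S : BfIdx → ℝ} (hR : ∀ i ∈ I, 0 ≤ R i)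
    (hS : ∀ i ∈ I, 0 ≤ S i) :
    0 ≤ ∑ i ∈ I, |bfCoeff N i| *
        ((((bfP hμν i).A + (bfP hμν i).B) * S i + R i * ((bfQ hμν i).A + (bfQ hμν i).B) + R i * S i)) := by
  refine Finset.sum_nonneg fun i hi => mul_nonneg (abs_nonneg _) ?_
  have := (bfP hμν i).nonneg_A; have := (bfP hμν i).nonneg_B; have := (bfQ hμν i).nonneg_A; have := (bfQ hμν i).nonneg_B
  have := hR i hi; have := hS i hi; positivity

/-- [folklore] **TWO FAMILIES AT A WINDOW POINT.**  If at `0 < ‖w‖∞ ≤ n` the stencil legs of BOTH `G₁` and `G₂` are within the (W2′)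
interface bounds `R_i/(‖w‖∞^{a_i−2}n²)`, `S_i/(‖w‖∞^{b_i−2}n²)` of the free table legs, then
`|stKI I G₁ (w) − stKI I G₂ (w)| ≤ 2·Dwin/(‖w‖∞²·n²)` — two applications of `inWindow_of_legPerturbation` against the common free
table integrand and the triangle inequality. -/
theorem abs_stKI_sub_stKI_le_of_window (hμν : μ ≠ ν) (N : ℝ) (I : Finset BfIdx) {n : ℕ} {w : Pt} (hw : w ≠ 0)
    (hwn : (supNorm w : ℝ) ≤ n) {G₁ G₂ : Pt → ℝ} {R S : BfIdx → ℝ} (hR : ∀ i ∈ I, 0 ≤ R i) (hS : ∀ i ∈ I, 0 ≤ S i)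
    (hP₁ : ∀ i ∈ I, |stP μ ν G₁ i w - (bfP hμν i).f n 0 w| ≤ R i / ((supNorm w : ℝ) ^ ((bfP hμν i).a - 2) * (n : ℝ) ^ 2))
    (hQ₁ : ∀ i ∈ I, |stQ μ ν G₁ i w - (bfQ hμν i).f n 0 w| ≤ S i / ((supNorm w : ℝ) ^ ((bfQ hμν i).a - 2) * (n : ℝ) ^ 2))
    (hP₂ : ∀ i ∈ I, |stP μ ν G₂ i w - (bfP hμν i).f n 0 w| ≤ R i / ((supNorm w : ℝ) ^ ((bfP hμν i).a - 2) * (n : ℝ) ^ 2))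
    (hQ₂ : ∀ i ∈ I, |stQ μ ν G₂ i w - (bfQ hμν i).f n 0 w| ≤ S i / ((supNorm w : ℝ) ^ ((bfQ hμν i).a - 2) * (n : ℝ) ^ 2)) :
    |stKI μ ν N I G₁ w - stKI μ ν N I G₂ w| ≤
      2 * (∑ i ∈ I, |bfCoeff N i| *
        ((((bfP hμν i).A + (bfP hμν i).B) * S i + R i * ((bfQ hμν i).A + (bfQ hμν i).B) + R i * S i))) /
        ((supNorm w : ℝ) ^ 2 * (n : ℝ) ^ 2) := by
  have hdeg : ∀ i ∈ I, (bfP hμν i).a + (bfQ hμν i).a = 6 := fun i _ => hdeg_bf hμν i (Finset.mem_univ i)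
  have h₁ := inWindow_of_legPerturbation (c := bfCoeff N) hdeg μ ν hw hwn hR hS hP₁ hQ₁
  have h₂ := inWindow_of_legPerturbation (c := bfCoeff N) hdeg μ ν hw hwn hR hS hP₂ hQ₂
  set T : ℝ := toReal w μ * toReal w ν * lattBubble I (bfCoeff N) (bfP hμν) (bfQ hμν) n 0 w with hT
  rw [stKI, stKI]
  calc |toReal w μ * toReal w ν * ∑ i ∈ I, bfCoeff N i * (stP μ ν G₁ i w * stQ μ ν G₁ i w) -
        toReal w μ * toReal w ν * ∑ i ∈ I, bfCoeff N i * (stP μ ν G₂ i w * stQ μ ν G₂ i w)|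
      = |(toReal w μ * toReal w ν * ∑ i ∈ I, bfCoeff N i * (stP μ ν G₁ i w * stQ μ ν G₁ i w) - T) -
          (toReal w μ * toReal w ν * ∑ i ∈ I, bfCoeff N i * (stP μ ν G₂ i w * stQ μ ν G₂ i w) - T)| := by ring_nf
    _ ≤ |toReal w μ * toReal w ν * ∑ i ∈ I, bfCoeff N i * (stP μ ν G₁ i w * stQ μ ν G₁ i w) - T| +
          |toReal w μ * toReal w ν * ∑ i ∈ I, bfCoeff N i * (stP μ ν G₂ i w * stQ μ ν G₂ i w) - T| := abs_sub _ _
    _ ≤ _ := by rw [two_mul, add_div]; exact add_le_add h₁ h₂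

end Window

/-! ## 4. Decay rows ⇒ the scale-`n` massive tail of the `I`-sector kernel -/

section Tail

/-- [folklore] The tail constant `Etail(I; A) = Σ_{i∈I} |bfCoeff_i|·A_{a_i−2}·(A_{b_i−2}·2^{b_i})` is nonnegative. -/
theorem tailConst_nonneg (hμν : μ ≠ ν) (N : ℝ) (I : Finset BfIdx) {A : ℕ → ℝ} (hA : ∀ j, 0 ≤ A j) :
    0 ≤ ∑ i ∈ I, |bfCoeff N i| * (A ((bfP hμν i).a - 2) * (A ((bfQ hμν i).a - 2) * 2 ^ (bfQ hμν i).a)) :=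
  Finset.sum_nonneg fun i _ => mul_nonneg (abs_nonneg _) (mul_nonneg (hA _) (mul_nonneg (hA _) (by positivity)))

/-- [folklore] **THE TAIL OF THE `I`-SECTOR KERNEL FROM GRADED DECAY.**  If `G` obeys the three decay rows with rate `c ≥ 0`
(`|G v| ≤ A₀e^{−c‖v‖∞}‖v‖∞⁻²`, unit differences `A₁e^{−c‖v‖∞}‖v‖∞⁻³`, mixed second difference `A₂e^{−c‖v‖∞}‖v‖∞⁻⁴`, `v ≠ 0`), then on the
shell `‖w‖∞ = r+1` with `r ≥ 1`: `|stKI I G (w)| ≤ Etail·(r+1)⁻⁴·e^{−c(r+1)}` (total degree six: `shellBound_of_legDecay` with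
`abs_stP_le_of_decay`/`abs_stQ_le_of_decay`). -/
theorem abs_stKI_le_of_decay (hμν : μ ≠ ν) (N : ℝ) (I : Finset BfIdx) {G : Pt → ℝ} {A : ℕ → ℝ} (hA : ∀ j, 0 ≤ A j) {c : ℝ}
    (hc : 0 ≤ c)
    (d0 : ∀ v : Pt, v ≠ 0 → |G v| ≤ A 0 * Real.exp (-c * supNorm v) / (supNorm v : ℝ) ^ 2)
    (d1 : ∀ v : Pt, v ≠ 0 → ∀ ρ : Fin 4, |G (v + unitVec ρ) - G v| ≤ A 1 * Real.exp (-c * supNorm v) / (supNorm v : ℝ) ^ 3)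
    (d2 : ∀ v : Pt, v ≠ 0 →
      |G (v + unitVec ν + unitVec μ) - G (v + unitVec ν) - G (v + unitVec μ) + G v| ≤ A 2 * Real.exp (-c * supNorm v) / (supNorm v : ℝ) ^ 4)
    {r : ℕ} (hr : 1 ≤ r) {w : Pt} (hw : w ∈ annulus 4 r (r + 1)) :
    |stKI μ ν N I G w| ≤ (∑ i ∈ I, |bfCoeff N i| * (A ((bfP hμν i).a - 2) * (A ((bfQ hμν i).a - 2) * 2 ^ (bfQ hμν i).a))) /
      ((r : ℝ) + 1) ^ 4 * Real.exp (-c * ((r : ℝ) + 1)) := by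
  have hdeg : ∀ i ∈ I, (bfP hμν i).a + (bfQ hμν i).a = 6 := fun i _ => hdeg_bf hμν i (Finset.mem_univ i)
  rw [stKI]
  exact shellBound_of_legDecay (c := bfCoeff N) hdeg μ ν hw (Real.exp_pos _).le (fun i _ => hA _)
    (fun i _ => abs_stP_le_of_decay hμν d0 d1 d2 hw i) (fun i _ => abs_stQ_le_of_decay hμν hA hc d0 d1 d2 hr hw i)

/-- [folklore] Hence the partial sums of the `I`-sector kernel converge (`fullSum (stKI I G)` is a genuine limit), for any rate `c > 0`. -/
theorem exists_tendsto_psum_stKI (hμν : μ ≠ ν) (N : ℝ) (I : Finset BfIdx) {G : Pt → ℝ} {A : ℕ → ℝ} (hA : ∀ j, 0 ≤ A j) {c : ℝ}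
    (hc : 0 < c)
    (d0 : ∀ v : Pt, v ≠ 0 → |G v| ≤ A 0 * Real.exp (-c * supNorm v) / (supNorm v : ℝ) ^ 2)
    (d1 : ∀ v : Pt, v ≠ 0 → ∀ ρ : Fin 4, |G (v + unitVec ρ) - G v| ≤ A 1 * Real.exp (-c * supNorm v) / (supNorm v : ℝ) ^ 3)
    (d2 : ∀ v : Pt, v ≠ 0 →
      |G (v + unitVec ν + unitVec μ) - G (v + unitVec ν) - G (v + unitVec μ) + G v| ≤ A 2 * Real.exp (-c * supNorm v) / (supNorm v : ℝ) ^ 4) :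
    ∃ B : ℝ, Tendsto (psum (stKI μ ν N I G)) atTop (𝓝 B) := by
  -- rate `c = c/1`: the shell bound holds from `M = 1` on with `Lr = 1`, `δ = c`
  refine exists_tendsto_psum_of_shellBound (M := 1) (Lr := 1) (δ := c) (tailConst_nonneg hμν N I hA) hc one_pos fun r hr w hw => ?_
  have h := abs_stKI_le_of_decay hμν N I hA hc.le d0 d1 d2 hr hw
  simpa using h

end Tail

/-! ## 5. THE RE-LEGGING BOUND at one scale -/

section Relegging

/-- [folklore] **RE-LEGGING AT ONE SCALE `n ≥ 2`.**  Two scalar leg kernels `G₁, G₂` that BOTH obey the six graded scalar rows of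
`SquareTable.oneLoopDrift_of_scalarBounds` at block size `n` — `h0/h1/h2` against `gFree` with `D₀/n², D₁/n³, D₂/n⁴` and `d0/d1/d2` with
`A_je^{−(δ/n)‖v‖∞}‖v‖∞^{−2−j}` — have `I`-sector full sums differing by at most `160·Dwin + 160·Etail·(1 + 1/δ)`, where
`Dwin = Σ_{i∈I}|bfCoeff_i|((A_{P_i}+B_{P_i})D_{b_i−2} + D_{a_i−2}(A_{Q_i}+B_{Q_i}) + D_{a_i−2}D_{b_i−2})`, `Etail = Σ_{i∈I}|bfCoeff_i|A_{a_i−2}A_{b_i−2}2^{b_i}`: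
NO dependence on `n` (window: `ScaledWindowCount` at `p = 2` with `C = 2·Dwin`; tail: `E = 2·Etail`). -/
theorem abs_fullSum_stKI_sub_le (hμν : μ ≠ ν) (N : ℝ) (I : Finset BfIdx) {n : ℕ} (hn : 2 ≤ n) {G₁ G₂ : Pt → ℝ}
    {D A : ℕ → ℝ} (hD : ∀ j, 0 ≤ D j) (hA : ∀ j, 0 ≤ A j) {δ : ℝ} (hδ : 0 < δ)
    (h0₁ : ∀ v, |G₁ v - gFree v| ≤ D 0 / (n : ℝ) ^ 2)
    (h1₁ : ∀ v (ρ : Fin 4), |(G₁ (v + unitVec ρ) - gFree (v + unitVec ρ)) - (G₁ v - gFree v)| ≤ D 1 / (n : ℝ) ^ 3)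
    (h2₁ : ∀ v, |(G₁ (v + unitVec ν + unitVec μ) - gFree (v + unitVec ν + unitVec μ)) - (G₁ (v + unitVec ν) - gFree (v + unitVec ν)) -
        (G₁ (v + unitVec μ) - gFree (v + unitVec μ)) + (G₁ v - gFree v)| ≤ D 2 / (n : ℝ) ^ 4)
    (d0₁ : ∀ v : Pt, v ≠ 0 → |G₁ v| ≤ A 0 * Real.exp (-(δ / n) * supNorm v) / (supNorm v : ℝ) ^ 2)
    (d1₁ : ∀ v : Pt, v ≠ 0 → ∀ ρ : Fin 4, |G₁ (v + unitVec ρ) - G₁ v| ≤ A 1 * Real.exp (-(δ / n) * supNorm v) / (supNorm v : ℝ) ^ 3)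
    (d2₁ : ∀ v : Pt, v ≠ 0 →
      |G₁ (v + unitVec ν + unitVec μ) - G₁ (v + unitVec ν) - G₁ (v + unitVec μ) + G₁ v| ≤
        A 2 * Real.exp (-(δ / n) * supNorm v) / (supNorm v : ℝ) ^ 4)
    (h0₂ : ∀ v, |G₂ v - gFree v| ≤ D 0 / (n : ℝ) ^ 2)
    (h1₂ : ∀ v (ρ : Fin 4), |(G₂ (v + unitVec ρ) - gFree (v + unitVec ρ)) - (G₂ v - gFree v)| ≤ D 1 / (n : ℝ) ^ 3)
    (h2₂ : ∀ v, |(G₂ (v + unitVec ν + unitVec μ) - gFree (v + unitVec ν + unitVec μ)) - (G₂ (v + unitVec ν) - gFree (v + unitVec ν)) -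
        (G₂ (v + unitVec μ) - gFree (v + unitVec μ)) + (G₂ v - gFree v)| ≤ D 2 / (n : ℝ) ^ 4)
    (d0₂ : ∀ v : Pt, v ≠ 0 → |G₂ v| ≤ A 0 * Real.exp (-(δ / n) * supNorm v) / (supNorm v : ℝ) ^ 2)
    (d1₂ : ∀ v : Pt, v ≠ 0 → ∀ ρ : Fin 4, |G₂ (v + unitVec ρ) - G₂ v| ≤ A 1 * Real.exp (-(δ / n) * supNorm v) / (supNorm v : ℝ) ^ 3)
    (d2₂ : ∀ v : Pt, v ≠ 0 →
      |G₂ (v + unitVec ν + unitVec μ) - G₂ (v + unitVec ν) - G₂ (v + unitVec μ) + G₂ v| ≤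
        A 2 * Real.exp (-(δ / n) * supNorm v) / (supNorm v : ℝ) ^ 4) :
    |fullSum (stKI μ ν N I G₁) - fullSum (stKI μ ν N I G₂)| ≤
      160 * (∑ i ∈ I, |bfCoeff N i| * ((((bfP hμν i).A + (bfP hμν i).B) * D ((bfQ hμν i).a - 2) +
          D ((bfP hμν i).a - 2) * ((bfQ hμν i).A + (bfQ hμν i).B) + D ((bfP hμν i).a - 2) * D ((bfQ hμν i).a - 2)))) +
      160 * (∑ i ∈ I, |bfCoeff N i| * (A ((bfP hμν i).a - 2) * (A ((bfQ hμν i).a - 2) * 2 ^ (bfQ hμν i).a))) * (1 + 1 / δ) := by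
  set Dw : ℝ := ∑ i ∈ I, |bfCoeff N i| * ((((bfP hμν i).A + (bfP hμν i).B) * D ((bfQ hμν i).a - 2) +
      D ((bfP hμν i).a - 2) * ((bfQ hμν i).A + (bfQ hμν i).B) + D ((bfP hμν i).a - 2) * D ((bfQ hμν i).a - 2))) with hDw
  set Et : ℝ := ∑ i ∈ I, |bfCoeff N i| * (A ((bfP hμν i).a - 2) * (A ((bfQ hμν i).a - 2) * 2 ^ (bfQ hμν i).a)) with hEt
  have hDw0 : 0 ≤ Dw := winConst_nonneg hμν N I (fun i _ => hD _) (fun i _ => hD _)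
  have hEt0 : 0 ≤ Et := tailConst_nonneg hμν N I hA
  have hn1 : 1 ≤ n := by omega
  have hn0 : (0 : ℝ) < n := by exact_mod_cast (show 0 < n by omega)
  have hc : (0 : ℝ) < δ / n := div_pos hδ hn0
  -- the difference kernel
  set K : Pt → ℝ := fun w => stKI μ ν N I G₁ w - stKI μ ν N I G₂ w with hK
  -- both full sums exist; the full sum of the difference is the difference of the full sums
  obtain ⟨B₁, hB₁⟩ := exists_tendsto_psum_stKI hμν N I hA hc d0₁ d1₁ d2₁
  obtain ⟨B₂, hB₂⟩ := exists_tendsto_psum_stKI hμν N I hA hc d0₂ d1₂ d2₂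
  have hpsum : psum K = fun R => psum (stKI μ ν N I G₁) R - psum (stKI μ ν N I G₂) R := by
    funext R
    simp only [hK, psum, Finset.sum_sub_distrib]
  have hKlim : Tendsto (psum K) atTop (𝓝 (B₁ - B₂)) := by rw [hpsum]; exact hB₁.sub hB₂
  have hfull : fullSum K = fullSum (stKI μ ν N I G₁) - fullSum (stKI μ ν N I G₂) := by
    rw [fullSum_eq_of_tendsto hKlim, fullSum_eq_of_tendsto hB₁, fullSum_eq_of_tendsto hB₂]
  rw [← hfull]
  -- window: `p = 2` class with `C = 2·Dw`
  have hwin : ∀ r : ℕ, r + 1 ≤ n → ∀ w ∈ annulus 4 r (r + 1),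
      |K w| ≤ 2 * Dw * ((r : ℝ) + 1) ^ (2 - 1) / (((r : ℝ) + 1) ^ 3 * (n : ℝ) ^ 2) := by
    intro r hr w hw
    have hw0 : w ≠ 0 := ne_zero_of_mem_annulus hw
    have hsup : (supNorm w : ℝ) = (r : ℝ) + 1 := by rw [supNorm_eq_of_mem_sphere hw]; push_cast; ring
    have hwn : (supNorm w : ℝ) ≤ n := by rw [hsup]; exact_mod_cast hr
    have h := abs_stKI_sub_stKI_le_of_window hμν N I hw0 hwn (R := fun i => D ((bfP hμν i).a - 2))
      (S := fun i => D ((bfQ hμν i).a - 2)) (fun i _ => hD _) (fun i _ => hD _)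
      (fun i _ => stP_window_of_rows hμν hD h0₁ h1₁ h2₁ hw0 hwn i) (fun i _ => stQ_window_of_rows hμν hD h0₁ h1₁ h2₁ hw0 hwn i)
      (fun i _ => stP_window_of_rows hμν hD h0₂ h1₂ h2₂ hw0 hwn i) (fun i _ => stQ_window_of_rows hμν hD h0₂ h1₂ h2₂ hw0 hwn i)
    have hr1 : (0 : ℝ) < (r : ℝ) + 1 := by positivity
    calc |K w| ≤ 2 * Dw / ((supNorm w : ℝ) ^ 2 * (n : ℝ) ^ 2) := h
      _ = 2 * Dw * ((r : ℝ) + 1) ^ (2 - 1) / (((r : ℝ) + 1) ^ 3 * (n : ℝ) ^ 2) := by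
          rw [hsup]; field_simp; ring
  -- tail: from `r ≥ n − 1 ≥ 1`, `E = 2·Et`, rate `δ/n`
  have htail : ∀ r : ℕ, n - 1 ≤ r → ∀ w ∈ annulus 4 r (r + 1),
      |K w| ≤ 2 * Et / ((r : ℝ) + 1) ^ 4 * Real.exp (-(δ / (n : ℝ)) * ((r : ℝ) + 1)) := by
    intro r hr w hw
    have hr1 : 1 ≤ r := by omega
    have h₁ := abs_stKI_le_of_decay hμν N I hA hc.le d0₁ d1₁ d2₁ hr1 hw
    have h₂ := abs_stKI_le_of_decay hμν N I hA hc.le d0₂ d1₂ d2₂ hr1 hw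
    calc |K w| ≤ |stKI μ ν N I G₁ w| + |stKI μ ν N I G₂ w| := abs_sub _ _
      _ ≤ Et / ((r : ℝ) + 1) ^ 4 * Real.exp (-(δ / (n : ℝ)) * ((r : ℝ) + 1)) +
            Et / ((r : ℝ) + 1) ^ 4 * Real.exp (-(δ / (n : ℝ)) * ((r : ℝ) + 1)) := add_le_add h₁ h₂
      _ = 2 * Et / ((r : ℝ) + 1) ^ 4 * Real.exp (-(δ / (n : ℝ)) * ((r : ℝ) + 1)) := by ring
  have h := abs_fullSum_le_of_scaledWindow (p := 2) hn1 (by norm_num) (by positivity) (by positivity) hδ hwin htail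
  calc |fullSum K| ≤ 80 * (2 * Dw) + 80 * (2 * Et) * (1 + 1 / δ) := h
    _ = 160 * Dw + 160 * Et * (1 + 1 / δ) := by ring

end Relegging

/-! ## 6. All scales, base-point averaged: the shape of `RoadEnd.d1Drift_of_strongRoad`'s rows -/

section Averaged

variable {κB : Type*}

/-- [folklore] **A2′, BASE-POINT-AVERAGED, ALL SCALES.**  Two leg families `G₁ n b, G₂ n b` (e.g. the ghost leg `γ` and the gluon diagonal
`σ = GfE`), BOTH obeying the twelve graded rows of `D1BFx.RoadEnd.d1Drift_of_strongRoad` (constants `D, A, δ` free of the base point), and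
convex base-point weights: for every `n ≥ 2` the averaged `I`-sector full sums differ by at most `160·Dwin + 160·Etail·(1 + 1/δ)` — the
ghost sector (I = `ghostIdx`) may be carried on either leg at `O(1)` cost, uniformly in the block size. -/
theorem abs_avg_fullSum_stKI_sub_le (hμν : μ ≠ ν) (N : ℝ) (I : Finset BfIdx) {Bset : ℕ → Finset κB} {wt : ℕ → κB → ℝ}
    {G₁ G₂ : ℕ → κB → Pt → ℝ} {D A : ℕ → ℝ} (hD : ∀ j, 0 ≤ D j) (hA : ∀ j, 0 ≤ A j) {δ : ℝ} (hδ : 0 < δ)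
    (hwt0 : ∀ n : ℕ, 2 ≤ n → ∀ b ∈ Bset n, 0 ≤ wt n b) (hwt1 : ∀ n : ℕ, 2 ≤ n → ∑ b ∈ Bset n, wt n b = 1)
    (h0₁ : ∀ n : ℕ, 2 ≤ n → ∀ b ∈ Bset n, ∀ v, |G₁ n b v - gFree v| ≤ D 0 / (n : ℝ) ^ 2)
    (h1₁ : ∀ n : ℕ, 2 ≤ n → ∀ b ∈ Bset n, ∀ v (ρ : Fin 4),
      |(G₁ n b (v + unitVec ρ) - gFree (v + unitVec ρ)) - (G₁ n b v - gFree v)| ≤ D 1 / (n : ℝ) ^ 3)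
    (h2₁ : ∀ n : ℕ, 2 ≤ n → ∀ b ∈ Bset n, ∀ v,
      |(G₁ n b (v + unitVec ν + unitVec μ) - gFree (v + unitVec ν + unitVec μ)) - (G₁ n b (v + unitVec ν) - gFree (v + unitVec ν)) -
          (G₁ n b (v + unitVec μ) - gFree (v + unitVec μ)) + (G₁ n b v - gFree v)| ≤ D 2 / (n : ℝ) ^ 4)
    (d0₁ : ∀ n : ℕ, 2 ≤ n → ∀ b ∈ Bset n, ∀ v : Pt, v ≠ 0 → |G₁ n b v| ≤ A 0 * Real.exp (-(δ / n) * supNorm v) / (supNorm v : ℝ) ^ 2)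
    (d1₁ : ∀ n : ℕ, 2 ≤ n → ∀ b ∈ Bset n, ∀ v : Pt, v ≠ 0 → ∀ ρ : Fin 4,
      |G₁ n b (v + unitVec ρ) - G₁ n b v| ≤ A 1 * Real.exp (-(δ / n) * supNorm v) / (supNorm v : ℝ) ^ 3)
    (d2₁ : ∀ n : ℕ, 2 ≤ n → ∀ b ∈ Bset n, ∀ v : Pt, v ≠ 0 →
      |G₁ n b (v + unitVec ν + unitVec μ) - G₁ n b (v + unitVec ν) - G₁ n b (v + unitVec μ) + G₁ n b v| ≤
        A 2 * Real.exp (-(δ / n) * supNorm v) / (supNorm v : ℝ) ^ 4)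
    (h0₂ : ∀ n : ℕ, 2 ≤ n → ∀ b ∈ Bset n, ∀ v, |G₂ n b v - gFree v| ≤ D 0 / (n : ℝ) ^ 2)
    (h1₂ : ∀ n : ℕ, 2 ≤ n → ∀ b ∈ Bset n, ∀ v (ρ : Fin 4),
      |(G₂ n b (v + unitVec ρ) - gFree (v + unitVec ρ)) - (G₂ n b v - gFree v)| ≤ D 1 / (n : ℝ) ^ 3)
    (h2₂ : ∀ n : ℕ, 2 ≤ n → ∀ b ∈ Bset n, ∀ v,
      |(G₂ n b (v + unitVec ν + unitVec μ) - gFree (v + unitVec ν + unitVec μ)) - (G₂ n b (v + unitVec ν) - gFree (v + unitVec ν)) -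
          (G₂ n b (v + unitVec μ) - gFree (v + unitVec μ)) + (G₂ n b v - gFree v)| ≤ D 2 / (n : ℝ) ^ 4)
    (d0₂ : ∀ n : ℕ, 2 ≤ n → ∀ b ∈ Bset n, ∀ v : Pt, v ≠ 0 → |G₂ n b v| ≤ A 0 * Real.exp (-(δ / n) * supNorm v) / (supNorm v : ℝ) ^ 2)
    (d1₂ : ∀ n : ℕ, 2 ≤ n → ∀ b ∈ Bset n, ∀ v : Pt, v ≠ 0 → ∀ ρ : Fin 4,
      |G₂ n b (v + unitVec ρ) - G₂ n b v| ≤ A 1 * Real.exp (-(δ / n) * supNorm v) / (supNorm v : ℝ) ^ 3)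
    (d2₂ : ∀ n : ℕ, 2 ≤ n → ∀ b ∈ Bset n, ∀ v : Pt, v ≠ 0 →
      |G₂ n b (v + unitVec ν + unitVec μ) - G₂ n b (v + unitVec ν) - G₂ n b (v + unitVec μ) + G₂ n b v| ≤
        A 2 * Real.exp (-(δ / n) * supNorm v) / (supNorm v : ℝ) ^ 4) :
    ∀ n : ℕ, 2 ≤ n →
      |∑ b ∈ Bset n, wt n b * fullSum (stKI μ ν N I (G₁ n b)) - ∑ b ∈ Bset n, wt n b * fullSum (stKI μ ν N I (G₂ n b))| ≤
        160 * (∑ i ∈ I, |bfCoeff N i| * ((((bfP hμν i).A + (bfP hμν i).B) * D ((bfQ hμν i).a - 2) +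
            D ((bfP hμν i).a - 2) * ((bfQ hμν i).A + (bfQ hμν i).B) + D ((bfP hμν i).a - 2) * D ((bfQ hμν i).a - 2)))) +
        160 * (∑ i ∈ I, |bfCoeff N i| * (A ((bfP hμν i).a - 2) * (A ((bfQ hμν i).a - 2) * 2 ^ (bfQ hμν i).a))) * (1 + 1 / δ) := by
  intro n hn
  set U : ℝ := 160 * (∑ i ∈ I, |bfCoeff N i| * ((((bfP hμν i).A + (bfP hμν i).B) * D ((bfQ hμν i).a - 2) +
      D ((bfP hμν i).a - 2) * ((bfQ hμν i).A + (bfQ hμν i).B) + D ((bfP hμν i).a - 2) * D ((bfQ hμν i).a - 2)))) +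
    160 * (∑ i ∈ I, |bfCoeff N i| * (A ((bfP hμν i).a - 2) * (A ((bfQ hμν i).a - 2) * 2 ^ (bfQ hμν i).a))) * (1 + 1 / δ) with hU
  have hb : ∀ b ∈ Bset n, |fullSum (stKI μ ν N I (G₁ n b)) - fullSum (stKI μ ν N I (G₂ n b))| ≤ U := fun b hb =>
    abs_fullSum_stKI_sub_le hμν N I hn hD hA hδ (h0₁ n hn b hb) (h1₁ n hn b hb) (h2₁ n hn b hb) (d0₁ n hn b hb) (d1₁ n hn b hb)
      (d2₁ n hn b hb) (h0₂ n hn b hb) (h1₂ n hn b hb) (h2₂ n hn b hb) (d0₂ n hn b hb) (d1₂ n hn b hb) (d2₂ n hn b hb)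
  rw [← Finset.sum_sub_distrib]
  calc |∑ b ∈ Bset n, (wt n b * fullSum (stKI μ ν N I (G₁ n b)) - wt n b * fullSum (stKI μ ν N I (G₂ n b)))|
      = |∑ b ∈ Bset n, wt n b * (fullSum (stKI μ ν N I (G₁ n b)) - fullSum (stKI μ ν N I (G₂ n b)))| := by
        congr 1; refine Finset.sum_congr rfl fun b _ => ?_; ring
    _ ≤ ∑ b ∈ Bset n, |wt n b * (fullSum (stKI μ ν N I (G₁ n b)) - fullSum (stKI μ ν N I (G₂ n b)))| :=
        Finset.abs_sum_le_sum_abs _ _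
    _ ≤ ∑ b ∈ Bset n, wt n b * U := by
        refine Finset.sum_le_sum fun b hb' => ?_
        rw [abs_mul, abs_of_nonneg (hwt0 n hn b hb')]
        exact mul_le_mul_of_nonneg_left (hb b hb') (hwt0 n hn b hb')
    _ = U := by rw [← Finset.sum_mul, hwt1 n hn, one_mul]

/-- [folklore] **A2′ IN `∃ U` FORM** (the constant hidden): under the hypotheses of `abs_avg_fullSum_stKI_sub_le` there is ONE `U`, free of the
block size and of the base point, bounding the averaged re-legging defect at every scale `n ≥ 2`. -/
theorem exists_avg_relegging_bound (hμν : μ ≠ ν) (N : ℝ) (I : Finset BfIdx) {Bset : ℕ → Finset κB} {wt : ℕ → κB → ℝ}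
    {G₁ G₂ : ℕ → κB → Pt → ℝ} {D A : ℕ → ℝ} (hD : ∀ j, 0 ≤ D j) (hA : ∀ j, 0 ≤ A j) {δ : ℝ} (hδ : 0 < δ)
    (hwt0 : ∀ n : ℕ, 2 ≤ n → ∀ b ∈ Bset n, 0 ≤ wt n b) (hwt1 : ∀ n : ℕ, 2 ≤ n → ∑ b ∈ Bset n, wt n b = 1)
    (h0₁ : ∀ n : ℕ, 2 ≤ n → ∀ b ∈ Bset n, ∀ v, |G₁ n b v - gFree v| ≤ D 0 / (n : ℝ) ^ 2)
    (h1₁ : ∀ n : ℕ, 2 ≤ n → ∀ b ∈ Bset n, ∀ v (ρ : Fin 4),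
      |(G₁ n b (v + unitVec ρ) - gFree (v + unitVec ρ)) - (G₁ n b v - gFree v)| ≤ D 1 / (n : ℝ) ^ 3)
    (h2₁ : ∀ n : ℕ, 2 ≤ n → ∀ b ∈ Bset n, ∀ v,
      |(G₁ n b (v + unitVec ν + unitVec μ) - gFree (v + unitVec ν + unitVec μ)) - (G₁ n b (v + unitVec ν) - gFree (v + unitVec ν)) -
          (G₁ n b (v + unitVec μ) - gFree (v + unitVec μ)) + (G₁ n b v - gFree v)| ≤ D 2 / (n : ℝ) ^ 4)
    (d0₁ : ∀ n : ℕ, 2 ≤ n → ∀ b ∈ Bset n, ∀ v : Pt, v ≠ 0 → |G₁ n b v| ≤ A 0 * Real.exp (-(δ / n) * supNorm v) / (supNorm v : ℝ) ^ 2)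
    (d1₁ : ∀ n : ℕ, 2 ≤ n → ∀ b ∈ Bset n, ∀ v : Pt, v ≠ 0 → ∀ ρ : Fin 4,
      |G₁ n b (v + unitVec ρ) - G₁ n b v| ≤ A 1 * Real.exp (-(δ / n) * supNorm v) / (supNorm v : ℝ) ^ 3)
    (d2₁ : ∀ n : ℕ, 2 ≤ n → ∀ b ∈ Bset n, ∀ v : Pt, v ≠ 0 →
      |G₁ n b (v + unitVec ν + unitVec μ) - G₁ n b (v + unitVec ν) - G₁ n b (v + unitVec μ) + G₁ n b v| ≤
        A 2 * Real.exp (-(δ / n) * supNorm v) / (supNorm v : ℝ) ^ 4)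
    (h0₂ : ∀ n : ℕ, 2 ≤ n → ∀ b ∈ Bset n, ∀ v, |G₂ n b v - gFree v| ≤ D 0 / (n : ℝ) ^ 2)
    (h1₂ : ∀ n : ℕ, 2 ≤ n → ∀ b ∈ Bset n, ∀ v (ρ : Fin 4),
      |(G₂ n b (v + unitVec ρ) - gFree (v + unitVec ρ)) - (G₂ n b v - gFree v)| ≤ D 1 / (n : ℝ) ^ 3)
    (h2₂ : ∀ n : ℕ, 2 ≤ n → ∀ b ∈ Bset n, ∀ v,
      |(G₂ n b (v + unitVec ν + unitVec μ) - gFree (v + unitVec ν + unitVec μ)) - (G₂ n b (v + unitVec ν) - gFree (v + unitVec ν)) -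
          (G₂ n b (v + unitVec μ) - gFree (v + unitVec μ)) + (G₂ n b v - gFree v)| ≤ D 2 / (n : ℝ) ^ 4)
    (d0₂ : ∀ n : ℕ, 2 ≤ n → ∀ b ∈ Bset n, ∀ v : Pt, v ≠ 0 → |G₂ n b v| ≤ A 0 * Real.exp (-(δ / n) * supNorm v) / (supNorm v : ℝ) ^ 2)
    (d1₂ : ∀ n : ℕ, 2 ≤ n → ∀ b ∈ Bset n, ∀ v : Pt, v ≠ 0 → ∀ ρ : Fin 4,
      |G₂ n b (v + unitVec ρ) - G₂ n b v| ≤ A 1 * Real.exp (-(δ / n) * supNorm v) / (supNorm v : ℝ) ^ 3)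
    (d2₂ : ∀ n : ℕ, 2 ≤ n → ∀ b ∈ Bset n, ∀ v : Pt, v ≠ 0 →
      |G₂ n b (v + unitVec ν + unitVec μ) - G₂ n b (v + unitVec ν) - G₂ n b (v + unitVec μ) + G₂ n b v| ≤
        A 2 * Real.exp (-(δ / n) * supNorm v) / (supNorm v : ℝ) ^ 4) :
    ∃ U : ℝ, 0 ≤ U ∧ ∀ n : ℕ, 2 ≤ n →
      |∑ b ∈ Bset n, wt n b * fullSum (stKI μ ν N I (G₁ n b)) - ∑ b ∈ Bset n, wt n b * fullSum (stKI μ ν N I (G₂ n b))| ≤ U := by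
  refine ⟨_, ?_, abs_avg_fullSum_stKI_sub_le hμν N I hD hA hδ hwt0 hwt1 h0₁ h1₁ h2₁ d0₁ d1₁ d2₁ h0₂ h1₂ h2₂ d0₂ d1₂ d2₂⟩
  have hDw := winConst_nonneg hμν N I (R := fun i => D ((bfP hμν i).a - 2)) (S := fun i => D ((bfQ hμν i).a - 2))
    (fun i _ => hD _) (fun i _ => hD _)
  have hEt := tailConst_nonneg hμν N I hA
  positivity

end Averaged

end

end Summit.QuantumFields.BalabanUV.Beta.D1BFx.GhostRelegging
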